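import Mathlib
import Summits.ValiantsHypothesis.ValiantsHypothesis.Theorems.GrenetZeonTwoDimCoefficientsScalingRankOneCoupling

/-!
# Crux `GrenetZeon.TwoDimCoefficients` (stmt-ValiantsHypothesis-8062) / rung `DualUnipotentThreeHalves` (stmt-24318):
# scaling-closure — COUPLING ⟷ BACK-COUPLING SYMMETRY of the two-level cut term; rank-one COUPLINGS are cheap

For a two-level block-triangular pencil `N = [[N₀, 0], [C, N₁]]` with back-coupling (cut part) `M^cut = [[0, B], [0, 0]]` the cut
term is `tr(N^k·M^cut) = Σ_{a+b=k−1} tr(N₁^a·C·N₀^b·B)` (`trace_fromBlocks_pow_mul_cut`), which is SYMMETRIC under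
`(N₀, N₁, C, B) ↦ (N₁, N₀, B, C)` (`trace_fromBlocks_pow_mul_cut_swap`): the coupling block `C` of the pencil and the back-coupling
`B` of the numerator play interchangeable roles, and the high constraints are the same numbers for both readings.  Consequently
✓ `rank_hess0_trace_pow_vecMulVec_le` (p838993: rank-one back-coupling costs `≤ 2(m+1)` at any nil-index) also prices a
RANK-ONE COUPLING `C = u·vᵀ` (`u` constant, `v` linear) against an ARBITRARY back-coupling `B`:

* ★ `rank_hess0_cutTerm_le_of_rankOne_coupling` — `rank Hess_z Σ_{a+b=n−2} tr(N₁^a·u vᵀ·N₀^b·B) ≤ 2(m+1)` (`m = |α| + |β|`), under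
  the high constraints `Σ_{a+b=k−1} tr(N₁^a·C·N₀^b·B) = 0` for `k ≥ n` (✓ `trace_pow_mul_cut_eq_zero_of_classIndex` supplies them).

(Block form over arbitrary finite index types; the transport to `Fin m` is internal, via `Fintype.equivFin` and `Matrix.reindex`.)

HONEST FRAMING: doubles the thin priced class of p838993 (rank-one coupling OR rank-one back-coupling); the full-rank constrained
cut term (P3′), the stub `DualUnipotentBound`, crux 8062, the 24318 decl and `VP ≠ VNP` remain open.

References: T. Mignon, N. Ressayre, Int. Math. Res. Not. 2004:79, Thm. 1.1 (via the tree); folklore.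
-/

-- single-conjunct layout `Summits/ValiantsHypothesis/ValiantsHypothesis`: the duplicated namespace
-- component is mandated by the tree.
set_option linter.dupNamespace false
set_option autoImplicit false

noncomputable section

namespace Summit.ValiantsHypothesis.ValiantsHypothesis.Theorems.GrenetZeonTwoDimCoefficients.ScalingClosure

open MvPolynomial Matrix
open Literature.Computability.AlgebraicComplexity
open Summit.ValiantsHypothesis.ValiantsHypothesis.Cruxes.TwoDimCoefficients.DimTwoCases

section CouplingSwap

variable {R : Type*} [CommRing R] {α β : Type*} [Fintype α] [Fintype β] [DecidableEq α] [DecidableEq β]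

/-- **Powers of a two-level block-triangular matrix**: `[[N₀, 0], [C, N₁]]^k = [[N₀^k, 0], [Σ_{i<k} N₁^i·C·N₀^{k−1−i}, N₁^k]]`.
[folklore] -/
theorem fromBlocks_zero₁₂_pow (N₀ : Matrix α α R) (C : Matrix β α R) (N₁ : Matrix β β R) (k : ℕ) :
    (fromBlocks N₀ 0 C N₁) ^ k =
      fromBlocks (N₀ ^ k) 0 (∑ i ∈ Finset.range k, N₁ ^ i * C * N₀ ^ (k - 1 - i)) (N₁ ^ k) := by
  induction k with
  | zero => rw [pow_zero, pow_zero, pow_zero, Finset.range_zero, Finset.sum_empty, ← fromBlocks_one]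
  | succ k ih =>
    rw [pow_succ, ih, fromBlocks_multiply]
    simp only [Matrix.mul_zero, Matrix.zero_mul, add_zero, zero_add, ← pow_succ]
    congr 1
    rw [Finset.sum_range_succ, Matrix.sum_mul]
    congr 1
    · refine Finset.sum_congr rfl fun i hi => ?_
      rw [Finset.mem_range] at hi
      rw [Matrix.mul_assoc, ← pow_succ, show k + 1 - 1 - i = k - 1 - i + 1 by omega]
    · rw [show k + 1 - 1 - k = 0 by omega, pow_zero, Matrix.mul_one]

omit [DecidableEq α] [DecidableEq β] in
/-- Trace of a block matrix. [folklore] -/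
theorem trace_fromBlocks' (A : Matrix α α R) (B : Matrix α β R) (C : Matrix β α R) (D : Matrix β β R) :
    (fromBlocks A B C D).trace = A.trace + D.trace := by
  simp [Matrix.trace, Fintype.sum_sum_type]

/-- **The two-level cut term**: `tr([[N₀,0],[C,N₁]]^k · [[0,B],[0,0]]) = Σ_{i<k} tr(N₁^i·C·N₀^{k−1−i}·B)`. [folklore] -/
theorem trace_fromBlocks_pow_mul_cut (N₀ : Matrix α α R) (C : Matrix β α R) (N₁ : Matrix β β R) (B : Matrix α β R)
    (k : ℕ) :
    ((fromBlocks N₀ 0 C N₁) ^ k * fromBlocks 0 B 0 0).trace =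
      ∑ i ∈ Finset.range k, (N₁ ^ i * C * N₀ ^ (k - 1 - i) * B).trace := by
  rw [fromBlocks_zero₁₂_pow, fromBlocks_multiply]
  simp only [Matrix.mul_zero, add_zero]
  rw [trace_fromBlocks', Matrix.trace_zero, zero_add, Matrix.sum_mul, Matrix.trace_sum]

/-- ★ **Coupling ⟷ back-coupling symmetry**: the cut term is unchanged under `(N₀, N₁, C, B) ↦ (N₁, N₀, B, C)`.
[folklore] -/
theorem trace_fromBlocks_pow_mul_cut_swap (N₀ : Matrix α α R) (C : Matrix β α R) (N₁ : Matrix β β R)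
    (B : Matrix α β R) (k : ℕ) :
    ((fromBlocks N₀ 0 C N₁) ^ k * fromBlocks 0 B 0 0).trace =
      ((fromBlocks N₁ 0 B N₀) ^ k * fromBlocks 0 C 0 0).trace := by
  rw [trace_fromBlocks_pow_mul_cut, trace_fromBlocks_pow_mul_cut, ← Finset.sum_range_reflect]
  refine Finset.sum_congr rfl fun i hi => ?_
  rw [Finset.mem_range] at hi
  rw [show k - 1 - (k - 1 - i) = i by omega, Matrix.mul_assoc (N₁ ^ (k - 1 - i) * C) (N₀ ^ i) B,
    Matrix.trace_mul_comm, ← Matrix.mul_assoc]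

/-- A two-level block-triangular matrix with nilpotent diagonal blocks is nilpotent. [folklore] -/
theorem fromBlocks_zero₁₂_pow_eq_zero (N₀ : Matrix α α R) (C : Matrix β α R) (N₁ : Matrix β β R) {p q : ℕ}
    (h₀ : N₀ ^ p = 0) (h₁ : N₁ ^ q = 0) : (fromBlocks N₀ 0 C N₁) ^ (p + q) = 0 := by
  rw [fromBlocks_zero₁₂_pow, pow_add, h₀, Matrix.zero_mul, pow_add, h₁, Matrix.mul_zero]
  have hsum : ∑ i ∈ Finset.range (p + q), N₁ ^ i * C * N₀ ^ (p + q - 1 - i) = 0 := by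
    refine Finset.sum_eq_zero fun i hi => ?_
    rw [Finset.mem_range] at hi
    rcases Nat.lt_or_ge i q with hiq | hiq
    · obtain ⟨d, hd⟩ : ∃ d, p + q - 1 - i = p + d := ⟨p + q - 1 - i - p, by omega⟩
      rw [hd, pow_add, h₀, Matrix.zero_mul, Matrix.mul_zero]
    · obtain ⟨d, hd⟩ : ∃ d, i = q + d := ⟨i - q, by omega⟩
      rw [hd, pow_add, h₁, Matrix.zero_mul, Matrix.zero_mul, Matrix.zero_mul]
  rw [hsum, ← fromBlocks_zero]

omit [Fintype α] [Fintype β] [DecidableEq α] [DecidableEq β] in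
/-- The cut matrix of a rank-one coupling is rank one: `[[0, u vᵀ], [0, 0]] = (u ⊕ 0)(0 ⊕ v)ᵀ`. [folklore] -/
theorem fromBlocks_vecMulVec_eq (u : α → R) (v : β → R) :
    fromBlocks (0 : Matrix α α R) (vecMulVec u v) 0 (0 : Matrix β β R) = vecMulVec (Sum.elim u 0) (Sum.elim 0 v) := by
  refine Matrix.ext fun i j => ?_
  rcases i with i | i <;> rcases j with j | j <;> simp [vecMulVec_apply]

section Transport

variable {ι : Type*} [Fintype ι] [DecidableEq ι] {m : ℕ} (e : ι ≃ Fin m)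

omit [DecidableEq ι] in
/-- Trace is invariant under re-indexing. [folklore] -/
theorem trace_reindex_self (A : Matrix ι ι R) : (Matrix.reindex e e A).trace = A.trace := by
  rw [Matrix.reindex_apply, Matrix.trace, Matrix.trace]
  exact Fintype.sum_equiv e.symm _ _ fun i => rfl

/-- Re-indexing commutes with powers. [folklore] -/
theorem reindex_pow (A : Matrix ι ι R) (k : ℕ) : (Matrix.reindex e e A) ^ k = Matrix.reindex e e (A ^ k) := by
  rw [← Matrix.coe_reindexAlgEquiv R R e, map_pow]

/-- Re-indexing commutes with products. [folklore] -/
theorem reindex_mul' (A B : Matrix ι ι R) :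
    Matrix.reindex e e A * Matrix.reindex e e B = Matrix.reindex e e (A * B) := by
  rw [← Matrix.coe_reindexAlgEquiv R R e, map_mul]

omit [Fintype ι] [DecidableEq ι] in
/-- Re-indexing a rank-one matrix. [folklore] -/
theorem reindex_vecMulVec (x y : ι → R) :
    Matrix.reindex e e (vecMulVec x y) = vecMulVec (x ∘ e.symm) (y ∘ e.symm) := by
  refine Matrix.ext fun i j => ?_
  rfl

end Transport

variable {n : ℕ}

/-- ★ **A rank-one COUPLING is cheap (any nil-index of the blocks' extension).**  Two-level pencil `N = [[N₀,0],[u vᵀ,N₁]]`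
(`N₀, N₁` nilpotent matrices of linear forms, `u` constant, `v` linear), ANY back-coupling `B` (linear), high constraints
`tr(N^k·[[0,B],[0,0]]) = 0` for `k ≥ n`.  Then the cut term `tr(N^{n−1}·[[0,B],[0,0]])` has Hessian rank `≤ 2(|α|+|β|+1)` at every
point. [cite: MignonRessayre2004, Thm. 1.1 — via the tree; folklore] -/
theorem rank_hess0_cutTerm_le_of_rankOne_coupling (hn : 2 ≤ n)
    (N₀ : Matrix α α (MvPolynomial (Fin n × Fin n) ℂ)) (N₁ : Matrix β β (MvPolynomial (Fin n × Fin n) ℂ))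
    (hN₀ : ∀ i j, (N₀ i j).IsHomogeneous 1) (hN₁ : ∀ i j, (N₁ i j).IsHomogeneous 1)
    {p q : ℕ} (hN₀p : N₀ ^ p = 0) (hN₁q : N₁ ^ q = 0)
    (u : β → ℂ) (v : α → MvPolynomial (Fin n × Fin n) ℂ) (hv : ∀ j, (v j).IsHomogeneous 1)
    (B : Matrix α β (MvPolynomial (Fin n × Fin n) ℂ)) (hB : ∀ i j, (B i j).IsHomogeneous 1)
    (hhigh : ∀ k, n ≤ k →
      ((fromBlocks N₀ 0 (vecMulVec (fun i => MvPolynomial.C (u i)) v) N₁) ^ k * fromBlocks 0 B 0 0).trace = 0)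
    (z : Fin n × Fin n → ℂ) :
    (hess0 (transl z (((fromBlocks N₀ 0 (vecMulVec (fun i => MvPolynomial.C (u i)) v) N₁) ^ (n - 1) *
      fromBlocks 0 B 0 0).trace))).rank ≤ 2 * (Fintype.card α + Fintype.card β + 1) := by
  classical
  -- swap: the cut term is the trace of the swapped pencil against the rank-one cut matrix
  set e : β ⊕ α ≃ Fin (Fintype.card β + Fintype.card α) :=
    (Fintype.equivFin (β ⊕ α)).trans (finCongr (Fintype.card_sum)) with he
  set N' : AffMat n (Fintype.card β + Fintype.card α) := Matrix.reindex e e (fromBlocks N₁ 0 B N₀) with hN'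
  have hswap : ∀ k, ((fromBlocks N₀ 0 (vecMulVec (fun i => MvPolynomial.C (u i)) v) N₁) ^ k * fromBlocks 0 B 0 0).trace =
      (N' ^ k * vecMulVec (fun i => MvPolynomial.C ((Sum.elim u 0 : β ⊕ α → ℂ) (e.symm i))) ((Sum.elim 0 v) ∘ e.symm)).trace := by
    intro k
    rw [trace_fromBlocks_pow_mul_cut_swap, fromBlocks_vecMulVec_eq, hN', reindex_pow, ← trace_reindex_self e
      ((fromBlocks N₁ 0 B N₀) ^ k * vecMulVec _ _), ← reindex_mul', reindex_vecMulVec]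
    congr 3
    funext i
    simp only [Function.comp_apply]
    cases e.symm i <;> simp
  have hN'hom : ∀ i j, (N' i j).IsHomogeneous 1 := by
    intro i j
    rw [hN', Matrix.reindex_apply, Matrix.submatrix_apply]
    rcases e.symm i with a | a <;> rcases e.symm j with b | b
    · simpa only [fromBlocks_apply₁₁] using hN₁ a b
    · simp only [fromBlocks_apply₁₂, Matrix.zero_apply]; exact isHomogeneous_zero _ _ _
    · simpa only [fromBlocks_apply₂₁] using hB a b
    · simpa only [fromBlocks_apply₂₂] using hN₀ a b
  have hN'nil : N' ^ (Fintype.card β + Fintype.card α) = 0 := by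
    refine Summit.ValiantsHypothesis.ValiantsHypothesis.Theorems.GrenetZeon.SlowCore.pow_card_eq_zero_of_pow_eq_zero N'
      (h := q + p) ?_
    rw [hN', reindex_pow, fromBlocks_zero₁₂_pow_eq_zero N₁ B N₀ hN₁q hN₀p, Matrix.reindex_apply, Matrix.submatrix_zero]
    rfl
  have hv' : ∀ j, (((Sum.elim 0 v : β ⊕ α → MvPolynomial (Fin n × Fin n) ℂ) ∘ e.symm) j).IsHomogeneous 1 := by
    intro j
    simp only [Function.comp_apply]
    rcases e.symm j with b | a
    · simp only [Sum.elim_inl, Pi.zero_apply]; exact isHomogeneous_zero _ _ _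
    · simp only [Sum.elim_inr]; exact hv a
  rw [hswap]
  have h := rank_hess0_trace_pow_vecMulVec_le hn N' hN'hom hN'nil (fun i => (Sum.elim u 0 : β ⊕ α → ℂ) (e.symm i))
    ((Sum.elim 0 v) ∘ e.symm) hv' (fun k hk => by rw [← hswap]; exact hhigh k hk) z
  calc _ ≤ 2 * (Fintype.card β + Fintype.card α + 1) := h
    _ = 2 * (Fintype.card α + Fintype.card β + 1) := by ring

end CouplingSwap

end Summit.ValiantsHypothesis.ValiantsHypothesis.Theorems.GrenetZeonTwoDimCoefficients.ScalingClosure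

end
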